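import Literature.AnabelianGeometry.EtaleTheta.Cor28iHeadFormInstances
import Literature.AnabelianGeometry.EtaleTheta.Discharge.Sec2Cor28iCoverOfRecordThetaRigidityAlone
import HarnessLib

/-!
# [EtTh] Cor 2.8 (i) in HEAD FORM at THE cover of record over the cusped inversion model `χ′`
# (`ThetaOrbitData.Cor28_i` itself, modulo ONE displayed hypothesis; proof-only knit, FACT-LIST row F-0640)

S. Mochizuki, *The étale theta function and its Frobenioid-theoretic manifestations* [EtTh], Publ. RIMS **45**
(2009), §2, Cor 2.8 (i) PRIMS PDF p.42; Prop 2.4 p.38, Def 2.7 p.41; §1 Thm 1.6 (ii)/(iii) p.24, Thm 1.10 (i) p.30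
(bib key `MochizukiEtTh2009`).

PROOF-ONLY companion (0 `def`, 0 `instance`, 0 notation, no new `Prop`; cell abc-iut, block F, seat abc-iut-f-193
gen 16 — row «F0640-HEAD-INSTANCE» §3, abc-iut-L2-lead R1498; sequel of this seat's `Cor28iHeadFormInstances` (§1 generic
orbit embedding, §2 SECTION-route cover) and the one-line specialisation of its §2′ (print-shaped hypothesis) at abc-iut-L2-d3's cover of record, in
the currency of abc-iut-L2-t1's `Sec2Cor28iCoverOfRecordThetaRigidityAlone` (★ `cor28_i_coverOfRecordχ'_of_thetaRigidity_alone`,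
which proves the 4-tuple C1–C4 per pair `(Γ, α)`; here the HEAD `O.Cor28_i` with the pair data universally closed into
ONE hypothesis).  Every input BY NAME: `isQuotientMap_toTheta_inversionModelχ'`, `MuTwoSetting.inversionModelχ'_compat`,
`ThetaSetting.modelχ'_sec2Hyps` (abc-iut-L2-d3 / abc-iut-f-151), `orbitEmbeddingOfHuuOfSection_map_GtpXu` (inside §2).)

**`SettingModel.cor28_i_coverOfRecordχ'_of_forall_extends`** — `(THE cover of record).Cor28_i` modulo `H`: every
topological automorphism `α` of the model's `Π^tp_X` that EXTENDS (`inclX ∘ α = Γ ∘ inclX`, Prop 2.4) to a topological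
automorphism `Γ` of `Π^tp_C` inducing `Γ_Θ` on `Δ_Θ`, permuting `Dtau = {ι(D_τ ∩ Π^tp_{X̲̲}), ι(D_{τ⁻¹} ∩ Π^tp_{X̲̲})}` and
stabilising `Π^tp_Ÿ` satisfies `α(Δ^tp_X) = Δ^tp_X` ([AbsAnab] Lem 1.3.8) and UNIT-FREE theta rigidity
`autMap α⁻¹ (topCompanion α)⁻¹ η̈^Θ = σ₀·η̈^Θ` (Thm 1.6 (ii)/(iii), Thm 1.10 (i) with unit `1`), `σ₀ ∈ Π^tp_{X̲̲}` (resp.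
`Π^tp_{X̲}`) when `Γ` stabilises it.

HONEST FRAMING / WHAT IS NOT CLAIMED: CONDITIONAL instance.  At THIS carrier the displayed `H` is literally the positive
form of the question «AUT-CLASSIFICATION @ modelχ′» — which continuous automorphisms of the model's
`Π^tp_X = (F̂₂ ×_Ẑ ℤ) ⋊_χ G_{ℚ_p}` permuting `D_{τ^{±1}}` extend to `Π^tp_C`, and do they all satisfy unit-free rigidity
with an integral, correctly located translation part? — sized UNDECIDABLE-WITH-TREE by abc-iut-f-142 (abc-iut-L2-lead
R1429, PARKED).  `H` is NOT proved and MAY FAIL here (then this instance is vacuous and `Cor28_i` may be refutable AS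
TYPED at this design carrier — which would not be a statement about [EtTh]); unit-free is STRONGER than print's
unit-carrying Thm 1.6 (iii) (abc-iut-L2-t1 `Sec2Cor28iArbitraryAut` §4, abc-iut-f-151 `conj_etaDdχ_eq_self_of_mem_GtpY`).
Conjunct 1 is unconditional in `Γ` here twice over (generic `isStandardColl_transport_etaZMu2`; abc-iut-f-151's
`isStandardColl_transport_etaZMu2_coverOfRecordχ'_tauχ'`).  The ∀-closure of `Cor28_i` is refuted (abc-iut-w4-d051's
`not_forall_cor28_i`).  Semi-synthetic model = consistency / non-vacuity bookkeeping for the TYPED interface only;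
[EtTh] is refereed and nothing of it is asserted; no side is taken on [IUTchIII] Cor 3.12; typed ≠ proved;
instantiated ≠ endorsed.
-/

noncomputable section

namespace Literature.AnabelianGeometry.EtaleTheta

open Literature.AnabelianGeometry.SemiGraphs ThetaCovers Literature.IUT.HodgeArakelov
open _root_.Topology
open ThetaSetting.EtaleThetaData.DoubleUnderline.OrbitEmbedding (symm_toTheta_eq)

namespace SettingModel

variable (p : ℕ) [Fact p.Prime]

/-- **[EtTh] Cor 2.8 (i) — `ThetaOrbitData.Cor28_i` IN HEAD FORM at THE cover of record** (abc-iut-L2-d3's section-route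
cover over `MuTwoSetting.inversionModelχ′`, class `etaDdχ`, Def 1.9 pair `tauχ′`/`tauInvχ′`; `p ≡ 1 (mod 4)`, odd `l`, every
once-punctured datum `eX`): `IsQuotientMap toTheta`, `Compat`, `Sec2Hyps`, `Π^tp_X = inclX(Π^tp_X)`, `ι(Π^tp_{X̲}) = T.tp T.PiXu`
are THEOREMS there, so the head holds modulo the ONE displayed hypothesis `H` of `Cor28iHeadFormInstances` §2′ read at the
model — every topological automorphism `α` of the model's `Π^tp_X` that EXTENDS to a topological automorphism `Γ` of `Π^tp_C`
inducing on `Δ_Θ`, permuting `Dtau` and stabilising `Π^tp_Ÿ` preserves `Δ^tp_X` and satisfies located UNIT-FREE theta rigidity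
for its companion `topCompanion α`.  HONEST LABEL: CONDITIONAL instance; at this carrier the truth of `H` is EXACTLY the positive
form of «AUT-CLASSIFICATION @ modelχ′» (abc-iut-f-142, abc-iut-L2-lead R1429: UNDECIDABLE-WITH-TREE, PARKED) — `H` is displayed,
NOT proved, and may fail at this semi-synthetic carrier; consistency / non-vacuity bookkeeping for the TYPED interface only.
[cite: MochizukiEtTh2009, Cor 2.8(i) p.42] -/
theorem cor28_i_coverOfRecordχ'_of_forall_extends (hp : p % 4 = 1) (l : ℕ+) (hodd : Odd ((l : ℕ+) : ℕ))
    (eX : (MuTwoSetting.inversionModelχ' p).toThetaSetting.OncePuncturedData)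
    (H : ∀ (Γ : ((cLevelDataInvχ' p).temperedCoverDataOfHuuOfSection (cLevelDataInvχ' p).toPiCHat
        (cLevelDataInvχ' p).isProfiniteCompletion_toPiCHat (cLevelDataInvχ' p).toPiCHat_injective eX hodd (sectionχ' p)
        (aug_sectionχ' p) (toZ_sectionχ' p) (inv_ell_piCData_inversionModelχ' p l eX)
        ((cLevelDataInvχ' p).map_inclX_GtpXu_normal l (kerToZIsCompactlyGenerated_modelχ' p))
        ((cLevelDataInvχ' p).map_inclX_GtpY_normal (kerToZIsCompactlyGenerated_modelχ' p)) (doubleUnderlineχ'Sec p l hodd)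
        (barKerTp_le_Huuχ_inversionModelχ' p l hodd) (fun σ => inr_mem_Huuχ p l σ) (epsPMInvχ_not_mem_range p)
        (iotaStable_conjX_epsPMInvχ' p (doubleUnderlineχ'Sec p l hodd) rfl)).Gtp ≃ₜ*
          ((cLevelDataInvχ' p).temperedCoverDataOfHuuOfSection (cLevelDataInvχ' p).toPiCHat
        (cLevelDataInvχ' p).isProfiniteCompletion_toPiCHat (cLevelDataInvχ' p).toPiCHat_injective eX hodd (sectionχ' p)
        (aug_sectionχ' p) (toZ_sectionχ' p) (inv_ell_piCData_inversionModelχ' p l eX)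
        ((cLevelDataInvχ' p).map_inclX_GtpXu_normal l (kerToZIsCompactlyGenerated_modelχ' p))
        ((cLevelDataInvχ' p).map_inclX_GtpY_normal (kerToZIsCompactlyGenerated_modelχ' p)) (doubleUnderlineχ'Sec p l hodd)
        (barKerTp_le_Huuχ_inversionModelχ' p l hodd) (fun σ => inr_mem_Huuχ p l σ) (epsPMInvχ_not_mem_range p)
        (iotaStable_conjX_epsPMInvχ' p (doubleUnderlineχ'Sec p l hodd) rfl)).Gtp)
        (ΓΘ : (ThetaOrbitData.ofEmbedding
      ((cLevelDataInvχ' p).orbitEmbeddingOfHuuOfSection (cLevelDataInvχ' p).toPiCHat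
        (cLevelDataInvχ' p).isProfiniteCompletion_toPiCHat (cLevelDataInvχ' p).toPiCHat_injective eX hodd (sectionχ' p)
        (aug_sectionχ' p) (toZ_sectionχ' p) (inv_ell_piCData_inversionModelχ' p l eX)
        ((cLevelDataInvχ' p).map_inclX_GtpXu_normal l (kerToZIsCompactlyGenerated_modelχ' p))
        ((cLevelDataInvχ' p).map_inclX_GtpY_normal (kerToZIsCompactlyGenerated_modelχ' p)) (doubleUnderlineχ'Sec p l hodd)
        (barKerTp_le_Huuχ_inversionModelχ' p l hodd) (fun σ => inr_mem_Huuχ p l σ) (epsPMInvχ_not_mem_range p)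
        (iotaStable_conjX_epsPMInvχ' p (doubleUnderlineχ'Sec p l hodd) rfl)
        (tauχ' p hp).toNonCuspidalPoint (tauInvχ' p hp).toNonCuspidalPoint)
      (MuTwoSetting.inversionModelχ'_compat p) (ThetaSetting.modelχ'_sec2Hyps p)).DeltaTheta ≃*
          (ThetaOrbitData.ofEmbedding
      ((cLevelDataInvχ' p).orbitEmbeddingOfHuuOfSection (cLevelDataInvχ' p).toPiCHat
        (cLevelDataInvχ' p).isProfiniteCompletion_toPiCHat (cLevelDataInvχ' p).toPiCHat_injective eX hodd (sectionχ' p)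
        (aug_sectionχ' p) (toZ_sectionχ' p) (inv_ell_piCData_inversionModelχ' p l eX)
        ((cLevelDataInvχ' p).map_inclX_GtpXu_normal l (kerToZIsCompactlyGenerated_modelχ' p))
        ((cLevelDataInvχ' p).map_inclX_GtpY_normal (kerToZIsCompactlyGenerated_modelχ' p)) (doubleUnderlineχ'Sec p l hodd)
        (barKerTp_le_Huuχ_inversionModelχ' p l hodd) (fun σ => inr_mem_Huuχ p l σ) (epsPMInvχ_not_mem_range p)
        (iotaStable_conjX_epsPMInvχ' p (doubleUnderlineχ'Sec p l hodd) rfl)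
        (tauχ' p hp).toNonCuspidalPoint (tauInvχ' p hp).toNonCuspidalPoint)
      (MuTwoSetting.inversionModelχ'_compat p) (ThetaSetting.modelχ'_sec2Hyps p)).DeltaTheta),
        (ThetaOrbitData.ofEmbedding
      ((cLevelDataInvχ' p).orbitEmbeddingOfHuuOfSection (cLevelDataInvχ' p).toPiCHat
        (cLevelDataInvχ' p).isProfiniteCompletion_toPiCHat (cLevelDataInvχ' p).toPiCHat_injective eX hodd (sectionχ' p)
        (aug_sectionχ' p) (toZ_sectionχ' p) (inv_ell_piCData_inversionModelχ' p l eX)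
        ((cLevelDataInvχ' p).map_inclX_GtpXu_normal l (kerToZIsCompactlyGenerated_modelχ' p))
        ((cLevelDataInvχ' p).map_inclX_GtpY_normal (kerToZIsCompactlyGenerated_modelχ' p)) (doubleUnderlineχ'Sec p l hodd)
        (barKerTp_le_Huuχ_inversionModelχ' p l hodd) (fun σ => inr_mem_Huuχ p l σ) (epsPMInvχ_not_mem_range p)
        (iotaStable_conjX_epsPMInvχ' p (doubleUnderlineχ'Sec p l hodd) rfl)
        (tauχ' p hp).toNonCuspidalPoint (tauInvχ' p hp).toNonCuspidalPoint)
      (MuTwoSetting.inversionModelχ'_compat p) (ThetaSetting.modelχ'_sec2Hyps p)).InducesOnTheta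
          Γ ΓΘ →
        (∀ Dt ∈ (ThetaOrbitData.ofEmbedding
      ((cLevelDataInvχ' p).orbitEmbeddingOfHuuOfSection (cLevelDataInvχ' p).toPiCHat
        (cLevelDataInvχ' p).isProfiniteCompletion_toPiCHat (cLevelDataInvχ' p).toPiCHat_injective eX hodd (sectionχ' p)
        (aug_sectionχ' p) (toZ_sectionχ' p) (inv_ell_piCData_inversionModelχ' p l eX)
        ((cLevelDataInvχ' p).map_inclX_GtpXu_normal l (kerToZIsCompactlyGenerated_modelχ' p))
        ((cLevelDataInvχ' p).map_inclX_GtpY_normal (kerToZIsCompactlyGenerated_modelχ' p)) (doubleUnderlineχ'Sec p l hodd)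
        (barKerTp_le_Huuχ_inversionModelχ' p l hodd) (fun σ => inr_mem_Huuχ p l σ) (epsPMInvχ_not_mem_range p)
        (iotaStable_conjX_epsPMInvχ' p (doubleUnderlineχ'Sec p l hodd) rfl)
        (tauχ' p hp).toNonCuspidalPoint (tauInvχ' p hp).toNonCuspidalPoint)
      (MuTwoSetting.inversionModelχ'_compat p) (ThetaSetting.modelχ'_sec2Hyps p)).Dtau,
          Dt.map Γ.toMulEquiv.toMonoidHom ∈ (ThetaOrbitData.ofEmbedding
      ((cLevelDataInvχ' p).orbitEmbeddingOfHuuOfSection (cLevelDataInvχ' p).toPiCHat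
        (cLevelDataInvχ' p).isProfiniteCompletion_toPiCHat (cLevelDataInvχ' p).toPiCHat_injective eX hodd (sectionχ' p)
        (aug_sectionχ' p) (toZ_sectionχ' p) (inv_ell_piCData_inversionModelχ' p l eX)
        ((cLevelDataInvχ' p).map_inclX_GtpXu_normal l (kerToZIsCompactlyGenerated_modelχ' p))
        ((cLevelDataInvχ' p).map_inclX_GtpY_normal (kerToZIsCompactlyGenerated_modelχ' p)) (doubleUnderlineχ'Sec p l hodd)
        (barKerTp_le_Huuχ_inversionModelχ' p l hodd) (fun σ => inr_mem_Huuχ p l σ) (epsPMInvχ_not_mem_range p)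
        (iotaStable_conjX_epsPMInvχ' p (doubleUnderlineχ'Sec p l hodd) rfl)
        (tauχ' p hp).toNonCuspidalPoint (tauInvχ' p hp).toNonCuspidalPoint)
      (MuTwoSetting.inversionModelχ'_compat p) (ThetaSetting.modelχ'_sec2Hyps p)).Dtau) →
        ((cLevelDataInvχ' p).temperedCoverDataOfHuuOfSection (cLevelDataInvχ' p).toPiCHat
        (cLevelDataInvχ' p).isProfiniteCompletion_toPiCHat (cLevelDataInvχ' p).toPiCHat_injective eX hodd (sectionχ' p)
        (aug_sectionχ' p) (toZ_sectionχ' p) (inv_ell_piCData_inversionModelχ' p l eX)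
        ((cLevelDataInvχ' p).map_inclX_GtpXu_normal l (kerToZIsCompactlyGenerated_modelχ' p))
        ((cLevelDataInvχ' p).map_inclX_GtpY_normal (kerToZIsCompactlyGenerated_modelχ' p)) (doubleUnderlineχ'Sec p l hodd)
        (barKerTp_le_Huuχ_inversionModelχ' p l hodd) (fun σ => inr_mem_Huuχ p l σ) (epsPMInvχ_not_mem_range p)
        (iotaStable_conjX_epsPMInvχ' p (doubleUnderlineχ'Sec p l hodd) rfl)).PiYddtp.map
            Γ.toMulEquiv.toMonoidHom =
          ((cLevelDataInvχ' p).temperedCoverDataOfHuuOfSection (cLevelDataInvχ' p).toPiCHat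
        (cLevelDataInvχ' p).isProfiniteCompletion_toPiCHat (cLevelDataInvχ' p).toPiCHat_injective eX hodd (sectionχ' p)
        (aug_sectionχ' p) (toZ_sectionχ' p) (inv_ell_piCData_inversionModelχ' p l eX)
        ((cLevelDataInvχ' p).map_inclX_GtpXu_normal l (kerToZIsCompactlyGenerated_modelχ' p))
        ((cLevelDataInvχ' p).map_inclX_GtpY_normal (kerToZIsCompactlyGenerated_modelχ' p)) (doubleUnderlineχ'Sec p l hodd)
        (barKerTp_le_Huuχ_inversionModelχ' p l hodd) (fun σ => inr_mem_Huuχ p l σ) (epsPMInvχ_not_mem_range p)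
        (iotaStable_conjX_epsPMInvχ' p (doubleUnderlineχ'Sec p l hodd) rfl)).PiYddtp →
        ∀ (α : (MuTwoSetting.inversionModelχ' p).PiTemp ≃ₜ* (MuTwoSetting.inversionModelχ' p).PiTemp),
          (∀ σ, (MuTwoSetting.inversionModelχ' p).inclX (α σ) = Γ ((MuTwoSetting.inversionModelχ' p).inclX σ)) →
        ∃ (hΔα : (MuTwoSetting.inversionModelχ' p).toThetaSetting.DeltaTemp.map α.toMulEquiv.toMonoidHom =
            (MuTwoSetting.inversionModelχ' p).toThetaSetting.DeltaTemp) (σ₀ : (MuTwoSetting.inversionModelχ' p).PiTemp),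
            ((((cLevelDataInvχ' p).temperedCoverDataOfHuuOfSection (cLevelDataInvχ' p).toPiCHat
        (cLevelDataInvχ' p).isProfiniteCompletion_toPiCHat (cLevelDataInvχ' p).toPiCHat_injective eX hodd (sectionχ' p)
        (aug_sectionχ' p) (toZ_sectionχ' p) (inv_ell_piCData_inversionModelχ' p l eX)
        ((cLevelDataInvχ' p).map_inclX_GtpXu_normal l (kerToZIsCompactlyGenerated_modelχ' p))
        ((cLevelDataInvχ' p).map_inclX_GtpY_normal (kerToZIsCompactlyGenerated_modelχ' p)) (doubleUnderlineχ'Sec p l hodd)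
        (barKerTp_le_Huuχ_inversionModelχ' p l hodd) (fun σ => inr_mem_Huuχ p l σ) (epsPMInvχ_not_mem_range p)
        (iotaStable_conjX_epsPMInvχ' p (doubleUnderlineχ'Sec p l hodd) rfl)).tp
                  ((cLevelDataInvχ' p).temperedCoverDataOfHuuOfSection (cLevelDataInvχ' p).toPiCHat
        (cLevelDataInvχ' p).isProfiniteCompletion_toPiCHat (cLevelDataInvχ' p).toPiCHat_injective eX hodd (sectionχ' p)
        (aug_sectionχ' p) (toZ_sectionχ' p) (inv_ell_piCData_inversionModelχ' p l eX)
        ((cLevelDataInvχ' p).map_inclX_GtpXu_normal l (kerToZIsCompactlyGenerated_modelχ' p))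
        ((cLevelDataInvχ' p).map_inclX_GtpY_normal (kerToZIsCompactlyGenerated_modelχ' p)) (doubleUnderlineχ'Sec p l hodd)
        (barKerTp_le_Huuχ_inversionModelχ' p l hodd) (fun σ => inr_mem_Huuχ p l σ) (epsPMInvχ_not_mem_range p)
        (iotaStable_conjX_epsPMInvχ' p (doubleUnderlineχ'Sec p l hodd) rfl)).PiXuu).map
                Γ.toMulEquiv.toMonoidHom =
              ((cLevelDataInvχ' p).temperedCoverDataOfHuuOfSection (cLevelDataInvχ' p).toPiCHat
        (cLevelDataInvχ' p).isProfiniteCompletion_toPiCHat (cLevelDataInvχ' p).toPiCHat_injective eX hodd (sectionχ' p)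
        (aug_sectionχ' p) (toZ_sectionχ' p) (inv_ell_piCData_inversionModelχ' p l eX)
        ((cLevelDataInvχ' p).map_inclX_GtpXu_normal l (kerToZIsCompactlyGenerated_modelχ' p))
        ((cLevelDataInvχ' p).map_inclX_GtpY_normal (kerToZIsCompactlyGenerated_modelχ' p)) (doubleUnderlineχ'Sec p l hodd)
        (barKerTp_le_Huuχ_inversionModelχ' p l hodd) (fun σ => inr_mem_Huuχ p l σ) (epsPMInvχ_not_mem_range p)
        (iotaStable_conjX_epsPMInvχ' p (doubleUnderlineχ'Sec p l hodd) rfl)).tp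
                ((cLevelDataInvχ' p).temperedCoverDataOfHuuOfSection (cLevelDataInvχ' p).toPiCHat
        (cLevelDataInvχ' p).isProfiniteCompletion_toPiCHat (cLevelDataInvχ' p).toPiCHat_injective eX hodd (sectionχ' p)
        (aug_sectionχ' p) (toZ_sectionχ' p) (inv_ell_piCData_inversionModelχ' p l eX)
        ((cLevelDataInvχ' p).map_inclX_GtpXu_normal l (kerToZIsCompactlyGenerated_modelχ' p))
        ((cLevelDataInvχ' p).map_inclX_GtpY_normal (kerToZIsCompactlyGenerated_modelχ' p)) (doubleUnderlineχ'Sec p l hodd)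
        (barKerTp_le_Huuχ_inversionModelχ' p l hodd) (fun σ => inr_mem_Huuχ p l σ) (epsPMInvχ_not_mem_range p)
        (iotaStable_conjX_epsPMInvχ' p (doubleUnderlineχ'Sec p l hodd) rfl)).PiXuu →
              σ₀ ∈ (doubleUnderlineχ'Sec p l hodd).Huu) ∧
            ((((cLevelDataInvχ' p).temperedCoverDataOfHuuOfSection (cLevelDataInvχ' p).toPiCHat
        (cLevelDataInvχ' p).isProfiniteCompletion_toPiCHat (cLevelDataInvχ' p).toPiCHat_injective eX hodd (sectionχ' p)
        (aug_sectionχ' p) (toZ_sectionχ' p) (inv_ell_piCData_inversionModelχ' p l eX)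
        ((cLevelDataInvχ' p).map_inclX_GtpXu_normal l (kerToZIsCompactlyGenerated_modelχ' p))
        ((cLevelDataInvχ' p).map_inclX_GtpY_normal (kerToZIsCompactlyGenerated_modelχ' p)) (doubleUnderlineχ'Sec p l hodd)
        (barKerTp_le_Huuχ_inversionModelχ' p l hodd) (fun σ => inr_mem_Huuχ p l σ) (epsPMInvχ_not_mem_range p)
        (iotaStable_conjX_epsPMInvχ' p (doubleUnderlineχ'Sec p l hodd) rfl)).tp
                  ((cLevelDataInvχ' p).temperedCoverDataOfHuuOfSection (cLevelDataInvχ' p).toPiCHat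
        (cLevelDataInvχ' p).isProfiniteCompletion_toPiCHat (cLevelDataInvχ' p).toPiCHat_injective eX hodd (sectionχ' p)
        (aug_sectionχ' p) (toZ_sectionχ' p) (inv_ell_piCData_inversionModelχ' p l eX)
        ((cLevelDataInvχ' p).map_inclX_GtpXu_normal l (kerToZIsCompactlyGenerated_modelχ' p))
        ((cLevelDataInvχ' p).map_inclX_GtpY_normal (kerToZIsCompactlyGenerated_modelχ' p)) (doubleUnderlineχ'Sec p l hodd)
        (barKerTp_le_Huuχ_inversionModelχ' p l hodd) (fun σ => inr_mem_Huuχ p l σ) (epsPMInvχ_not_mem_range p)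
        (iotaStable_conjX_epsPMInvχ' p (doubleUnderlineχ'Sec p l hodd) rfl)).PiXu).map
                Γ.toMulEquiv.toMonoidHom =
              ((cLevelDataInvχ' p).temperedCoverDataOfHuuOfSection (cLevelDataInvχ' p).toPiCHat
        (cLevelDataInvχ' p).isProfiniteCompletion_toPiCHat (cLevelDataInvχ' p).toPiCHat_injective eX hodd (sectionχ' p)
        (aug_sectionχ' p) (toZ_sectionχ' p) (inv_ell_piCData_inversionModelχ' p l eX)
        ((cLevelDataInvχ' p).map_inclX_GtpXu_normal l (kerToZIsCompactlyGenerated_modelχ' p))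
        ((cLevelDataInvχ' p).map_inclX_GtpY_normal (kerToZIsCompactlyGenerated_modelχ' p)) (doubleUnderlineχ'Sec p l hodd)
        (barKerTp_le_Huuχ_inversionModelχ' p l hodd) (fun σ => inr_mem_Huuχ p l σ) (epsPMInvχ_not_mem_range p)
        (iotaStable_conjX_epsPMInvχ' p (doubleUnderlineχ'Sec p l hodd) rfl)).tp
                ((cLevelDataInvχ' p).temperedCoverDataOfHuuOfSection (cLevelDataInvχ' p).toPiCHat
        (cLevelDataInvχ' p).isProfiniteCompletion_toPiCHat (cLevelDataInvχ' p).toPiCHat_injective eX hodd (sectionχ' p)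
        (aug_sectionχ' p) (toZ_sectionχ' p) (inv_ell_piCData_inversionModelχ' p l eX)
        ((cLevelDataInvχ' p).map_inclX_GtpXu_normal l (kerToZIsCompactlyGenerated_modelχ' p))
        ((cLevelDataInvχ' p).map_inclX_GtpY_normal (kerToZIsCompactlyGenerated_modelχ' p)) (doubleUnderlineχ'Sec p l hodd)
        (barKerTp_le_Huuχ_inversionModelχ' p l hodd) (fun σ => inr_mem_Huuχ p l σ) (epsPMInvχ_not_mem_range p)
        (iotaStable_conjX_epsPMInvχ' p (doubleUnderlineχ'Sec p l hodd) rfl)).PiXu →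
              σ₀ ∈ (MuTwoSetting.inversionModelχ' p).toThetaSetting.GtpXu l) ∧
            ∀ (hΔ' : ∀ a, a ∈ (MuTwoSetting.inversionModelχ' p).toThetaSetting.DeltaTheta →
                (Thm16Sub.topCompanion (MuTwoSetting.inversionModelχ' p).toThetaSetting (MuTwoSetting.inversionModelχ' p).toThetaSetting α hΔα
                  (isQuotientMap_toTheta_inversionModelχ' p) (isQuotientMap_toTheta_inversionModelχ' p)).symm a ∈
                  (MuTwoSetting.inversionModelχ' p).toThetaSetting.DeltaTheta)
              (hYα : ∀ g, g ∈ (MuTwoSetting.inversionModelχ' p).toThetaSetting.GtpYdd → α g ∈ (MuTwoSetting.inversionModelχ' p).toThetaSetting.GtpYdd),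
              haveI := (MuTwoSetting.inversionModelχ'_compat p).GtpYdd_normal
              ContH1Aut.autMap (MuTwoSetting.inversionModelχ' p).toTheta (MuTwoSetting.inversionModelχ' p).toThetaSetting.DeltaTheta α.symm
                  (Thm16Sub.topCompanion (MuTwoSetting.inversionModelχ' p).toThetaSetting (MuTwoSetting.inversionModelχ' p).toThetaSetting α hΔα
                    (isQuotientMap_toTheta_inversionModelχ' p) (isQuotientMap_toTheta_inversionModelχ' p)).symm
                  (symm_toTheta_eq (fun σ => Thm16Sub.algCompanion_apply_toTheta (MuTwoSetting.inversionModelχ' p).toThetaSetting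
                    (MuTwoSetting.inversionModelχ' p).toThetaSetting α hΔα σ)) hΔ'
                  (H := (MuTwoSetting.inversionModelχ' p).toThetaSetting.GtpYdd) (H' := (MuTwoSetting.inversionModelχ' p).toThetaSetting.GtpYdd) hYα
                  ((kummerDataχ'Sec p).etaleThetaDataOfClass (etaDdχ p)).etaDd =
                ContH1.conj (MuTwoSetting.inversionModelχ' p).toTheta (MuTwoSetting.inversionModelχ' p).toThetaSetting.DeltaTheta σ₀
                  ((kummerDataχ'Sec p).etaleThetaDataOfClass (etaDdχ p)).etaDd) :
    (ThetaOrbitData.ofEmbedding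
      ((cLevelDataInvχ' p).orbitEmbeddingOfHuuOfSection (cLevelDataInvχ' p).toPiCHat
        (cLevelDataInvχ' p).isProfiniteCompletion_toPiCHat (cLevelDataInvχ' p).toPiCHat_injective eX hodd (sectionχ' p)
        (aug_sectionχ' p) (toZ_sectionχ' p) (inv_ell_piCData_inversionModelχ' p l eX)
        ((cLevelDataInvχ' p).map_inclX_GtpXu_normal l (kerToZIsCompactlyGenerated_modelχ' p))
        ((cLevelDataInvχ' p).map_inclX_GtpY_normal (kerToZIsCompactlyGenerated_modelχ' p)) (doubleUnderlineχ'Sec p l hodd)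
        (barKerTp_le_Huuχ_inversionModelχ' p l hodd) (fun σ => inr_mem_Huuχ p l σ) (epsPMInvχ_not_mem_range p)
        (iotaStable_conjX_epsPMInvχ' p (doubleUnderlineχ'Sec p l hodd) rfl)
        (tauχ' p hp).toNonCuspidalPoint (tauInvχ' p hp).toNonCuspidalPoint)
      (MuTwoSetting.inversionModelχ'_compat p) (ThetaSetting.modelχ'_sec2Hyps p)).Cor28_i :=
  (cLevelDataInvχ' p).cor28_i_orbitEmbeddingOfHuuOfSection_of_forall_extends _ _ _ eX hodd _ _ _ _ _ _
    (doubleUnderlineχ'Sec p l hodd) _ _ _ _ _ _ (isQuotientMap_toTheta_inversionModelχ' p) (MuTwoSetting.inversionModelχ'_compat p)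
    (ThetaSetting.modelχ'_sec2Hyps p) H

end SettingModel

end Literature.AnabelianGeometry.EtaleTheta

end
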